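import Summits.CriticalPhenomena.SAWScalingLimit.Theorems.SAWDevelopingMapHexTightReversalDefs
import Summits.CriticalPhenomena.SAWScalingLimit.Theorems.HexTight.Negative.OneScaleDiveChains

/-!
# `OneScaleDive` off criticality, part 2: the statement at fugacity `x`, counting arcs from a door, building arcs
(negative lemma for crux `HexTight`, stmt-CriticalPhenomena-5423, line `reversal-virgin-disc`, stub 2)

drefute generation 2 (refuter, 2026-08-16). Main file and discussion: `Negative/OneScaleDiveSubcritical.lean`.
Over the LANDED objects of `Theorems/SAWDevelopingMapHexTightReversalDefs.lean` (`IsHArc`, `IsVirgin`, `Straddles`):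
* `arcMassAt x`, `diveMassAt x`, `stayMassAt x` and **`OneScaleDiveAt x`** — the registered `stub_oneScaleDive` with
  `x_c` replaced by `x`; `oneScaleDiveAt_critical_iff : OneScaleDiveAt x_c ↔ <stub verbatim>` is `Iff.rfl`; likewise
  `BulkOneArmDecayAt x` (the line's milestone M1) and `oneScaleDiveAt_of_bulk` (its level `m = 1` IS the dive bound);
* **`card_filter_length_eq_le`**: from a door `{u, c}` (`u ∉ Λ`) there are at most `3^{n-1}` arcs with `n` cells, and
  **`sum_pow_length_ge_le`**: `Σ_{ℓ(γ) ≥ n₁} x^{ℓ(γ)} ≤ (3x)^{n₁}/(1-3x)` for `0 ≤ x < 1/3` (any `Λ`, any end `w'`);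
* **`mkArc`**: a `HexMidEdgeSAW Λ {u,c} {u',c'}` from a duplicate-free lattice chain `c … c'` in `Λ` with `u, u' ∉ Λ`,
  `u ∼ c` and `{u,c} ≠ {u',c'}` (the `edges_nodup` bookkeeping closes because `u, u' ∉ Λ`).
-/

noncomputable section

open scoped BigOperators
open Classical
open Literature.Probability.LatticeModels Literature.Probability.RandomPlanarGeometry
  Literature.Probability.RandomPlanarGeometry.SAW
open Summit.CriticalPhenomena.SAWScalingLimit.Theorems.HexTight.Reversal

namespace Summit.CriticalPhenomena.SAWScalingLimit.Cruxes.HexTight.Negative.Subcritical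

/-! ## The one-scale dive statement at a general fugacity -/

/-- `Z^H_Λ(w → w')` at fugacity `x`: `Σ_{H-arcs} x^{ℓ(γ)}` (at `x = x_c` this is `Reversal.arcMass`). -/
def arcMassAt (x : ℝ) (H : SimpleGraph HexVertex) (Λ : Finset HexVertex) (w w' : Sym2 HexVertex) : ℝ :=
  ∑ γ : HexMidEdgeSAW Λ w w', if IsHArc H γ then x ^ γ.length else 0

/-- the `x`-mass of the `H`-arcs `w → w'` of `Λ` visiting the closed disc `B̄(z₀, r)`
(at `x = x_c` this is `Reversal.diveMass`). -/
def diveMassAt (x : ℝ) (H : SimpleGraph HexVertex) (Λ : Finset HexVertex) (w w' : Sym2 HexVertex)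
    (z₀ : ℂ) (r : ℝ) : ℝ :=
  ∑ γ : HexMidEdgeSAW Λ w w',
    if IsHArc H γ ∧ ∃ v ∈ γ.verts, dist (hexCenter v) z₀ ≤ r then x ^ γ.length else 0

/-- the mass of the NON-diving `H`-arcs at fugacity `x`. -/
def stayMassAt (x : ℝ) (H : SimpleGraph HexVertex) (Λ : Finset HexVertex) (w w' : Sym2 HexVertex)
    (z₀ : ℂ) (r : ℝ) : ℝ :=
  ∑ γ : HexMidEdgeSAW Λ w w',
    if IsHArc H γ ∧ ¬ ∃ v ∈ γ.verts, dist (hexCenter v) z₀ ≤ r then x ^ γ.length else 0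

/-- **`OneScaleDive` at fugacity `x`**: the statement of `stub_oneScaleDive` with `x_c` replaced by `x`. -/
def OneScaleDiveAt (x : ℝ) : Prop :=
  ∃ q : ℝ, 0 ≤ q ∧ q < 1 ∧ ∃ N₀ : ℝ, ∀ (H : SimpleGraph HexVertex) (Λ : Finset HexVertex)
    (z₀ : ℂ) (N : ℝ) (w w' : Sym2 HexVertex), N₀ ≤ N →
    IsVirgin H Λ z₀ N → Straddles Λ z₀ N w → Straddles Λ z₀ N w' →
    diveMassAt x H Λ w w' z₀ (N / 2) ≤ q * arcMassAt x H Λ w w'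

/-- At `x = x_c`, `OneScaleDiveAt` is VERBATIM the registered stub `stub_oneScaleDive` of the line
(stated over the landed objects `Reversal.diveMass` / `Reversal.arcMass`; inside this namespace the bare
name `arcMass` would resolve to the pinned copy of `Negative/LatticeG2Defs.lean`, hence the full names). -/
theorem oneScaleDiveAt_critical_iff :
    OneScaleDiveAt hexCriticalFugacity ↔
      ∃ q : ℝ, 0 ≤ q ∧ q < 1 ∧ ∃ N₀ : ℝ, ∀ (H : SimpleGraph HexVertex) (Λ : Finset HexVertex)
        (z₀ : ℂ) (N : ℝ) (w w' : Sym2 HexVertex), N₀ ≤ N →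
        IsVirgin H Λ z₀ N → Straddles Λ z₀ N w → Straddles Λ z₀ N w' →
        Summit.CriticalPhenomena.SAWScalingLimit.Theorems.HexTight.Reversal.diveMass H Λ w w' z₀ (N / 2) ≤
          q * Summit.CriticalPhenomena.SAWScalingLimit.Theorems.HexTight.Reversal.arcMass H Λ w w' :=
  Iff.rfl

/-- **`BulkOneArmDecay` at fugacity `x`**: the line's milestone M1 (`bulkOneArmDecay_of`, proved there from
`DiveRecursion` + `OneScaleDive`) with `x_c` replaced by `x`. -/
def BulkOneArmDecayAt (x : ℝ) : Prop :=
  ∃ q : ℝ, 0 ≤ q ∧ q < 1 ∧ ∃ N₀ : ℝ, ∀ (m : ℕ) (H : SimpleGraph HexVertex)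
    (Λ : Finset HexVertex) (z₀ : ℂ) (N : ℝ) (w w' : Sym2 HexVertex), N₀ ≤ N →
    IsVirgin H Λ z₀ (2 ^ m * N) → Straddles Λ z₀ (2 ^ m * N) w →
    Straddles Λ z₀ (2 ^ m * N) w' →
    diveMassAt x H Λ w w' z₀ N ≤ q ^ m * arcMassAt x H Λ w w'

/-- At `x = x_c`, `BulkOneArmDecayAt` is VERBATIM the line's `BulkOneArmDecay`. -/
theorem bulkOneArmDecayAt_critical_iff :
    BulkOneArmDecayAt hexCriticalFugacity ↔
      ∃ q : ℝ, 0 ≤ q ∧ q < 1 ∧ ∃ N₀ : ℝ, ∀ (m : ℕ) (H : SimpleGraph HexVertex)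
        (Λ : Finset HexVertex) (z₀ : ℂ) (N : ℝ) (w w' : Sym2 HexVertex), N₀ ≤ N →
        IsVirgin H Λ z₀ (2 ^ m * N) → Straddles Λ z₀ (2 ^ m * N) w →
        Straddles Λ z₀ (2 ^ m * N) w' →
        Summit.CriticalPhenomena.SAWScalingLimit.Theorems.HexTight.Reversal.diveMass H Λ w w' z₀ N ≤
          q ^ m * Summit.CriticalPhenomena.SAWScalingLimit.Theorems.HexTight.Reversal.arcMass H Λ w w' :=
  Iff.rfl

/-- the one-arm decay at level `m = 1` is the one-scale dive bound (at every fugacity) -/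
theorem oneScaleDiveAt_of_bulk {x : ℝ} (h : BulkOneArmDecayAt x) : OneScaleDiveAt x := by
  obtain ⟨q, hq0, hq1, N₀, h⟩ := h
  refine ⟨q, hq0, hq1, 2 * N₀, fun H Λ z₀ N w w' hN hV hw hw' => ?_⟩
  have e : (2 : ℝ) ^ 1 * (N / 2) = N := by ring
  have key := h 1 H Λ z₀ (N / 2) w w' (by linarith) (by rw [e]; exact hV) (by rw [e]; exact hw)
    (by rw [e]; exact hw')
  simpa only [pow_one] using key

variable {x : ℝ} {H : SimpleGraph HexVertex} {Λ : Finset HexVertex} {w w' : Sym2 HexVertex}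
  {z₀ : ℂ} {r : ℝ}

/-- arc mass = dive mass + stay mass (termwise). -/
theorem arcMassAt_eq_add (x : ℝ) (H : SimpleGraph HexVertex) (Λ : Finset HexVertex)
    (w w' : Sym2 HexVertex) (z₀ : ℂ) (r : ℝ) :
    arcMassAt x H Λ w w' = diveMassAt x H Λ w w' z₀ r + stayMassAt x H Λ w w' z₀ r := by
  unfold arcMassAt diveMassAt stayMassAt
  rw [← Finset.sum_add_distrib]
  refine Finset.sum_congr rfl fun γ _ => ?_
  by_cases hA : IsHArc H γ
  · by_cases hB : ∃ v ∈ γ.verts, dist (hexCenter v) z₀ ≤ r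
    · rw [if_pos hA, if_pos ⟨hA, hB⟩, if_neg (fun h => h.2 hB), add_zero]
    · rw [if_pos hA, if_neg (fun h => hB h.2), if_pos ⟨hA, hB⟩, zero_add]
  · rw [if_neg hA, if_neg (fun h => hA h.1), if_neg (fun h => hA h.1), add_zero]

/-- In a domain `Λ`, from a door `w = {u, c}` with `u ∉ Λ`: every nonempty arc starts at `c`. -/
theorem head_eq_of_door {u c : HexVertex} (hu : u ∉ Λ) (γ : HexMidEdgeSAW Λ s(u, c) w')
    (hne : γ.verts ≠ []) : γ.verts.head hne = c := by
  have hmem := γ.head_mem (γ.verts.head hne) (List.head?_eq_some_head hne)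
  rcases Sym2.mem_iff.1 hmem with h | h
  · exact absurd (h ▸ γ.subset _ (List.head_mem hne)) hu
  · exact h

/-- **at most `3^{n-1}` arcs with `n` cells from a door** -/
theorem card_filter_length_eq_le {u c : HexVertex} (hu : u ∉ Λ) (n : ℕ) :
    (Finset.univ.filter fun γ : HexMidEdgeSAW Λ s(u, c) w' => γ.length = n).card ≤ 3 ^ (n - 1) := by
  classical
  rw [← Fintype.card_subtype]
  have hlen : ∀ γ : {γ : HexMidEdgeSAW Λ s(u, c) w' // γ.length = n},
      (code γ.1.verts).length = n - 1 := by
    rintro ⟨γ, hγ⟩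
    rcases h : γ.verts with _ | ⟨a, l⟩
    · have : γ.length = 0 := by simp [HexMidEdgeSAW.length, h]
      simp only [code, List.length_nil]
      omega
    · rw [length_code]
      have : γ.length = l.length + 1 := by simp [HexMidEdgeSAW.length, h]
      omega
  let f : {γ : HexMidEdgeSAW Λ s(u, c) w' // γ.length = n} → List.Vector (Fin 3) (n - 1) :=
    fun γ => ⟨code γ.1.verts, hlen γ⟩
  have hf : Function.Injective f := by
    rintro ⟨γ₁, hγ₁⟩ ⟨γ₂, hγ₂⟩ heq
    have heq' : code γ₁.verts = code γ₂.verts := congrArg Subtype.val heq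
    rw [Subtype.mk.injEq]
    apply HexMidEdgeSAW.ext
    rcases h₁ : γ₁.verts with _ | ⟨a₁, l₁⟩ <;> rcases h₂ : γ₂.verts with _ | ⟨a₂, l₂⟩
    · rfl
    · exfalso
      have e1 : γ₁.length = 0 := by simp [HexMidEdgeSAW.length, h₁]
      have e2 : γ₂.length = l₂.length + 1 := by simp [HexMidEdgeSAW.length, h₂]
      omega
    · exfalso
      have e1 : γ₁.length = l₁.length + 1 := by simp [HexMidEdgeSAW.length, h₁]
      have e2 : γ₂.length = 0 := by simp [HexMidEdgeSAW.length, h₂]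
      omega
    · have ha₁ : a₁ = c := by
        have := head_eq_of_door (w' := w') hu γ₁ (by rw [h₁]; simp)
        simpa [h₁] using this
      have ha₂ : a₂ = c := by
        have := head_eq_of_door (w' := w') hu γ₂ (by rw [h₂]; simp)
        simpa [h₂] using this
      rw [ha₁] at h₁ ⊢
      rw [ha₂] at h₂ ⊢
      have hc₁ : (c :: l₁).IsChain hexGraph.Adj := h₁ ▸ γ₁.isChain
      have hc₂ : (c :: l₂).IsChain hexGraph.Adj := h₂ ▸ γ₂.isChain
      rw [h₁, h₂] at heq'
      rw [← decode_code l₁ c hc₁, ← decode_code l₂ c hc₂, heq']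
  calc Fintype.card {γ : HexMidEdgeSAW Λ s(u, c) w' // γ.length = n}
      ≤ Fintype.card (List.Vector (Fin 3) (n - 1)) := Fintype.card_le_of_injective f hf
    _ = 3 ^ (n - 1) := by rw [card_vector, Fintype.card_fin]

/-- an arc has at most `|Λ|` cells -/
theorem length_le_card (γ : HexMidEdgeSAW Λ w w') : γ.length ≤ Λ.card := by
  rw [HexMidEdgeSAW.length, ← List.toFinset_card_of_nodup γ.nodup]
  exact Finset.card_le_card fun v hv => γ.subset v (List.mem_toFinset.1 hv)

/-- **the mass of the long arcs from a door**: `Σ_{ℓ(γ) ≥ n₁} x^{ℓ(γ)} ≤ (3x)^{n₁} / (1 - 3x)`. -/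
theorem sum_pow_length_ge_le {u c : HexVertex} (hu : u ∉ Λ) {x : ℝ} (hx : 0 ≤ x) (h3x : 3 * x < 1)
    (n₁ : ℕ) :
    (∑ γ : HexMidEdgeSAW Λ s(u, c) w', if n₁ ≤ γ.length then x ^ γ.length else 0) ≤
      (3 * x) ^ n₁ / (1 - 3 * x) := by
  classical
  set B := Λ.card + 1 with hB
  have hfib : ∀ γ : HexMidEdgeSAW Λ s(u, c) w', (if n₁ ≤ γ.length then x ^ γ.length else 0) =
      ∑ n ∈ Finset.Ico n₁ B, if γ.length = n then x ^ n else 0 := by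
    intro γ
    rw [Finset.sum_ite_eq]
    have hlt : γ.length < B := Nat.lt_succ_of_le (length_le_card γ)
    by_cases hn : n₁ ≤ γ.length
    · rw [if_pos hn, if_pos (Finset.mem_Ico.2 ⟨hn, hlt⟩)]
    · rw [if_neg hn, if_neg (fun h => hn (Finset.mem_Ico.1 h).1)]
  rw [Finset.sum_congr rfl (fun γ _ => hfib γ), Finset.sum_comm]
  have h3x0 : 0 ≤ 3 * x := by positivity
  refine le_trans (Finset.sum_le_sum fun n hn => ?_) (geom_sum_Ico_le_of_lt_one h3x0 h3x)
  have hcount : (∑ γ : HexMidEdgeSAW Λ s(u, c) w', if γ.length = n then x ^ n else (0 : ℝ)) =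
      ((Finset.univ.filter fun γ : HexMidEdgeSAW Λ s(u, c) w' => γ.length = n).card : ℝ) * x ^ n := by
    rw [Finset.sum_ite, Finset.sum_const_zero, add_zero, Finset.sum_const, nsmul_eq_mul]
  rw [hcount]
  have hcard := card_filter_length_eq_le (w' := w') (Λ := Λ) (c := c) hu n
  calc ((Finset.univ.filter fun γ : HexMidEdgeSAW Λ s(u, c) w' => γ.length = n).card : ℝ) * x ^ n
      ≤ (3 : ℝ) ^ (n - 1) * x ^ n :=
        mul_le_mul_of_nonneg_right (by exact_mod_cast hcard) (pow_nonneg hx n)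
    _ ≤ 3 ^ n * x ^ n :=
        mul_le_mul_of_nonneg_right (pow_le_pow_right₀ (by norm_num) (Nat.sub_le n 1)) (pow_nonneg hx n)
    _ = (3 * x) ^ n := by rw [mul_pow]

/-! ## Building a door-to-door arc from a duplicate-free lattice chain -/

/-- the consecutive-pair edges of a list have their endpoints in the list -/
theorem mem_of_mem_zipWith_mk : ∀ (l : List HexVertex) (e : Sym2 HexVertex),
    e ∈ List.zipWith (fun a b => s(a, b)) l l.tail → ∀ z ∈ e, z ∈ l
  | [], e, he => by simp at he
  | [a], e, he => by simp at he
  | a :: b :: l, e, he => by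
    simp only [List.tail_cons, List.zipWith_cons_cons, List.mem_cons] at he
    intro z hz
    rcases he with rfl | he
    · rcases Sym2.mem_iff.1 hz with rfl | rfl <;> simp
    · exact List.mem_cons_of_mem a (mem_of_mem_zipWith_mk (b :: l) e he z hz)

/-- a duplicate-free list has duplicate-free consecutive-pair edges -/
theorem nodup_zipWith_mk : ∀ (l : List HexVertex), l.Nodup →
    (List.zipWith (fun a b => s(a, b)) l l.tail).Nodup
  | [], _ => by simp
  | [a], _ => by simp
  | a :: b :: l, h => by
    have hn : (b :: l).Nodup := h.of_cons
    have ha : a ∉ b :: l := (List.nodup_cons.1 h).1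
    simp only [List.tail_cons, List.zipWith_cons_cons, List.nodup_cons]
    refine ⟨fun hmem => ha ?_, nodup_zipWith_mk (b :: l) hn⟩
    exact mem_of_mem_zipWith_mk (b :: l) _ hmem a (Sym2.mem_mk_left a b)

/-- **a door-to-door arc from a duplicate-free lattice chain** whose end cells are `c`, `c'`, with
outside cells `u, u' ∉ Λ` (`u ∼ c`) and distinct doors. -/
def mkArc (l : List HexVertex) (hl : l ≠ []) (hnd : l.Nodup) (hc : l.IsChain hexGraph.Adj)
    (hΛ : ∀ v ∈ l, v ∈ Λ) {u u' c c' : HexVertex} (hu : u ∉ Λ) (hu' : u' ∉ Λ)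
    (hhead : l.head hl = c) (hlast : l.getLast hl = c')
    (hadj : hexGraph.Adj u c) (hne : s(u, c) ≠ s(u', c')) :
    HexMidEdgeSAW Λ s(u, c) s(u', c') where
  verts := l
  subset := hΛ
  nodup := hnd
  isChain := hc
  head_mem v hv := by
    rw [List.head?_eq_some_head hl, Option.some.injEq] at hv
    rw [← hv, hhead]
    exact Sym2.mem_mk_right u c
  getLast_mem v hv := by
    rw [List.getLast?_eq_some_getLast hl, Option.some.injEq] at hv
    rw [← hv, hlast]
    exact Sym2.mem_mk_right u' c'
  eq_of_nil h := absurd h hl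
  edges_nodup _ := by
    have hw' : s(u', c') ∉ List.zipWith (fun a b => s(a, b)) l l.tail := fun h =>
      hu' (hΛ u' (mem_of_mem_zipWith_mk l _ h u' (Sym2.mem_mk_left u' c')))
    have hw : s(u, c) ∉ List.zipWith (fun a b => s(a, b)) l l.tail := fun h =>
      hu (hΛ u (mem_of_mem_zipWith_mk l _ h u (Sym2.mem_mk_left u c)))
    rw [List.nodup_append_comm, List.singleton_append, List.nodup_cons, List.nodup_cons, List.mem_cons,
      not_or]
    exact ⟨⟨hne.symm, hw'⟩, hw, nodup_zipWith_mk l hnd⟩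
  fst_mem := ⟨(SimpleGraph.mem_edgeSet hexGraph).2 hadj, c, Sym2.mem_mk_right u c,
    hΛ c (hhead ▸ List.head_mem hl)⟩

/-- the cells of `mkArc` -/
@[simp] theorem mkArc_verts (l : List HexVertex) (hl : l ≠ []) (hnd : l.Nodup)
    (hc : l.IsChain hexGraph.Adj) (hΛ : ∀ v ∈ l, v ∈ Λ) {u u' c c' : HexVertex} (hu : u ∉ Λ)
    (hu' : u' ∉ Λ) (hhead : l.head hl = c) (hlast : l.getLast hl = c') (hadj : hexGraph.Adj u c)
    (hne : s(u, c) ≠ s(u', c')) :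
    (mkArc l hl hnd hc hΛ hu hu' hhead hlast hadj hne).verts = l := rfl

/-- from a door `{u', c'}` at the end (`u' ∉ Λ`): every nonempty arc ends at `c'` -/
theorem getLast_eq_of_door {u' c' : HexVertex} (hu' : u' ∉ Λ) (γ : HexMidEdgeSAW Λ w s(u', c'))
    (hne : γ.verts ≠ []) : γ.verts.getLast hne = c' := by
  have hmem := γ.getLast_mem (γ.verts.getLast hne) (List.getLast?_eq_some_getLast hne)
  rcases Sym2.mem_iff.1 hmem with h | h
  · exact absurd (h ▸ γ.subset _ (List.getLast_mem hne)) hu'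
  · exact h


end Summit.CriticalPhenomena.SAWScalingLimit.Cruxes.HexTight.Negative.Subcritical

end
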